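import Mathlib
import Literature.MathematicalPhysics.StatisticalMechanics.BarlowStacking
import Literature.MathematicalPhysics.StatisticalMechanics.HaggStacking
import Summits.AtomisticToContinuum.Crystallization.Theorems.PricedLinkCensusStackingHingeWords

/-!
# Route PricedLinkCensus — unmatched sites of an ideal polytype lie near its bad bonds
(stub `stub_unmatchedNearBadBond` of line Sketch, crux `StackingHinge`, stmt-AtomisticToContinuum-14993)

Pure Barlow-stacking geometry.  Fix the hcp scale `(a₀, h₀)` (`a₀, h₀ > 0`) and a window
`(R, ε)`.  For the exact uniform Barlow stacking `Q = barlowPeriodicConfiguration s ha hh hp hs`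
of a `p`-periodic Hägg word `s` at a scale `(a, h)` with `|a - a₀|, |h - h₀| ≤ δ`, the motif points
`x_m = barlowPos a h s m 0 0`, `m < p`, whose `R`-window in `Q.points = barlowStacking a h s` is
NOT two-way `ε`-matched with a rigid image of `barlowStacking a₀ h₀ alternatingHagg` number at
most `(2K + 1) · b_p`, `b_p = #{m < p : s (m+1) = s m}` the number of bad bonds (cubic layers) per
period; here `K = ⌈2(R + ε)/h₀⌉₊` and `δ = min (min (a₀/2) (h₀/2)) (ε / (2R(1/a₀ + 1/h₀) + 1))`.

* §1 WORDS: a Hägg word with no bad bond within `K` of `m` agrees, re-based at `m`, with a shift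
  of the alternating word on `[-K, K]` (`exists_eqOn_alternating`).
* §2 GEOMETRY (`matched_of_eqOn`): if `s (· + m)` and `t (· + u)` agree on `[-K, K]`, the
  translation `g` taking `z₀ = barlowPos a₀ h₀ t u 0 0` to `x = barlowPos a h s m 0 0` matches the
  `R`-window of `x` in `barlowStacking a h s` two-way with `g '' barlowStacking a₀ h₀ t` up to `ε`:
  re-based at `x` resp. `z₀`, both stackings are, inside the ball of radius `R + ε ≤ K h₀ / 2`,
  the stacking of the SAME word at the two scales (`mem_barlowStacking_iff_sub_mem_shift`,
  `mem_barlowStacking_of_eqOn`), and equal-index points at `δ`-close scales are within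
  `(2δ/a₀ + 2δ/h₀) R ≤ ε` (`dist_barlowPos_le_of_haggLabel_eq`).
* §3 COUNTING: hence an unmatched `m < p` has a bad bond `k ∈ ℤ` with `|k - m| ≤ K`; its residue
  `k mod p` is a bad bond in `[0, p)` and `m = (k mod p + d) mod p` with `d = m - k ∈ [-K, K]`, so
  the unmatched indices are covered by `b_p` sets of size `≤ 2K + 1` (`mem_cover_of_badBond`,
  `card_cover_le`, `natCard_motif_le_of_cover`, `natCard_unmatched_le`).

All `[folklore]`.
-/

namespace Summit.AtomisticToContinuum.Crystallization.Theorems.PricedHcpWindowsIdealGeometry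

open Literature.MathematicalPhysics.StatisticalMechanics Literature.Geometry.DiscreteGeometry

/-! ### §1 Words without bad bonds are locally alternating -/

/-- **No bad bond near `m` ⇒ locally alternating.**  If the Hägg word `s` has no bad bond
`s (k + 1) = s k` with `|k - m| ≤ K`, then the re-based word `s (· + m)` agrees on `[-K, K]` with a
shift `alternatingHagg (· + u)` of the alternating word (`alt (n + 1) = -alt n`, cf.
`CLayerWitnessWitness.alternatingHagg_succ`, restated inline to keep the imports inside the route).
[folklore] -/
theorem exists_eqOn_alternating {s : ℤ → ℤ} (hs : IsHaggSeq s) {m : ℤ} {K : ℕ}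
    (hgood : ∀ k : ℤ, |k - m| ≤ K → s (k + 1) ≠ s k) :
    ∃ u : ℤ, ∀ n : ℤ, -(K : ℤ) ≤ n → n ≤ K → s (n + m) = alternatingHagg (n + u) := by
  have halt : ∀ n : ℤ, alternatingHagg (n + 1) = -alternatingHagg n := fun n => by
    unfold alternatingHagg
    by_cases hn : Even n
    · have h1 : ¬ Even (n + 1) := by simpa [Int.even_add_one] using hn
      simp [hn, h1]
    · have h1 : Even (n + 1) := by simpa [Int.even_add_one] using hn
      simp [hn, h1]
  have hflip : ∀ k : ℤ, |k - m| ≤ K → s (k + 1) = -s k := fun k hk => by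
    have h0 := hs k
    have h1 := hs (k + 1)
    have h2 := hgood k hk
    omega
  obtain ⟨u, hu⟩ : ∃ u : ℤ, alternatingHagg u = s m := by
    rcases hs m with h | h
    · exact ⟨0, by rw [h]; simp [alternatingHagg]⟩
    · exact ⟨1, by rw [h]; simp [alternatingHagg]⟩
  refine ⟨u, fun n => ?_⟩
  induction n using Int.induction_on with
  | zero => intro _ _; simpa using hu.symm
  | succ i ih =>
    intro h1 h2
    have ih' := ih (by omega) (by omega)
    have hf := hflip ((i : ℤ) + m) (by rw [add_sub_cancel_right, abs_le]; omega)
    rw [show (i : ℤ) + 1 + m = (i : ℤ) + m + 1 by ring, hf, ih',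
      show (i : ℤ) + 1 + u = (i : ℤ) + u + 1 by ring, halt]
  | pred i ih =>
    intro h1 h2
    have ih' := ih (by omega) (by omega)
    have hf := hflip (-(i : ℤ) - 1 + m) (by rw [add_sub_cancel_right, abs_le]; omega)
    rw [show -(i : ℤ) - 1 + m + 1 = -(i : ℤ) + m by ring, ih'] at hf
    have ha := halt (-(i : ℤ) - 1 + u)
    rw [show -(i : ℤ) - 1 + u + 1 = -(i : ℤ) + u by ring] at ha
    linarith

/-! ### §2 Geometry: locally equal words at close scales give matched windows -/

/-- **Matched windows.**  Let `a₀, h₀ > 0`, `δ ≤ a₀/2`, `δ ≤ h₀/2`, `δ · 2R(1/a₀ + 1/h₀) ≤ ε`,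
`R + ε ≤ K h₀/2`, and `|a - a₀|, |h - h₀| ≤ δ`.  If the words `s (· + m)` and `t (· + u)` agree on
`[-K, K]`, then the `R`-window of `x = barlowPos a h s m 0 0` in `barlowStacking a h s` is two-way
`ε`-matched with the image of `barlowStacking a₀ h₀ t` under the translation taking
`barlowPos a₀ h₀ t u 0 0` to `x`. [folklore] -/
theorem matched_of_eqOn {a₀ h₀ R ε δ : ℝ} {K : ℕ} (ha₀ : 0 < a₀) (hh₀ : 0 < h₀) (hε : 0 ≤ ε)
    (hδa : δ ≤ a₀ / 2) (hδh : δ ≤ h₀ / 2) (hδε : δ * (2 * R * (1 / a₀ + 1 / h₀)) ≤ ε)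
    (hK : R + ε ≤ K * (h₀ / 2)) {a h : ℝ} (ha : a ≠ 0) (hh : h ≠ 0)
    (haδ : |a - a₀| ≤ δ) (hhδ : |h - h₀| ≤ δ) {s t : ℤ → ℤ} {m u : ℤ}
    (hu : ∀ n : ℤ, -(K : ℤ) ≤ n → n ≤ K → s (n + m) = t (n + u)) :
    ∃ g : EuclideanSpace ℝ (Fin 3) ≃ᵃⁱ[ℝ] EuclideanSpace ℝ (Fin 3),
      (∀ y ∈ barlowStacking a h s, dist (barlowPos a h s m 0 0) y ≤ R →
        ∃ z ∈ barlowStacking a₀ h₀ t, dist y (g z) ≤ ε) ∧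
      (∀ z ∈ barlowStacking a₀ h₀ t, dist (barlowPos a h s m 0 0) (g z) ≤ R →
        ∃ y ∈ barlowStacking a h s, dist y (g z) ≤ ε) := by
  -- the scale bounds
  have hδ0 : 0 ≤ δ := (abs_nonneg _).trans haδ
  have haa : a₀ / 2 ≤ |a| := by
    have h1 := abs_sub_abs_le_abs_sub a₀ a
    rw [abs_sub_comm, abs_of_pos ha₀] at h1
    linarith
  have hha : h₀ / 2 ≤ |h| := by
    have h1 := abs_sub_abs_le_abs_sub h₀ h
    rw [abs_sub_comm, abs_of_pos hh₀] at h1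
    linarith
  have hμ1 : |a - a₀| / |a| + |h - h₀| / |h| ≤ δ / (a₀ / 2) + δ / (h₀ / 2) :=
    add_le_add (div_le_div₀ hδ0 haδ (by positivity) haa) (div_le_div₀ hδ0 hhδ (by positivity) hha)
  have hμ2 : |a₀ - a| / |a₀| + |h₀ - h| / |h₀| ≤ δ / (a₀ / 2) + δ / (h₀ / 2) := by
    rw [abs_sub_comm a₀ a, abs_sub_comm h₀ h, abs_of_pos ha₀, abs_of_pos hh₀]
    exact add_le_add (div_le_div₀ hδ0 haδ (by positivity) (by linarith))
      (div_le_div₀ hδ0 hhδ (by positivity) (by linarith))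
  have hμ0 : 0 ≤ δ / (a₀ / 2) + δ / (h₀ / 2) := by positivity
  have hμR : (δ / (a₀ / 2) + δ / (h₀ / 2)) * R ≤ ε := by
    have : (δ / (a₀ / 2) + δ / (h₀ / 2)) * R = δ * (2 * R * (1 / a₀ + 1 / h₀)) := by
      field_simp
    rw [this]
    exact hδε
  have hKh : R + ε ≤ K * |h| := hK.trans (mul_le_mul_of_nonneg_left hha (Nat.cast_nonneg _))
  set x := barlowPos a h s m 0 0 with hx
  set z₀ := barlowPos a₀ h₀ t u 0 0 with hz₀
  have hg : ∀ z, (AffineIsometryEquiv.constVAdd ℝ (EuclideanSpace ℝ (Fin 3)) (x - z₀)) z =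
      x - z₀ + z := fun z => rfl
  refine ⟨AffineIsometryEquiv.constVAdd ℝ (EuclideanSpace ℝ (Fin 3)) (x - z₀), ?_, ?_⟩
  · -- clause 1: a point `y` of the stacking near `x` is near the image of an hcp point
    intro y hy hxy
    have h1 : y - x ∈ barlowStacking a h (fun n => s (n + m)) :=
      (mem_barlowStacking_iff_sub_mem_shift (m := m) (i₀ := 0) (j₀ := 0) y).1 hy
    have hn : ‖y - x‖ ≤ K * |h| := by
      rw [← dist_eq_norm, dist_comm]
      linarith
    have h2 : y - x ∈ barlowStacking a h (fun n => t (n + u)) :=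
      mem_barlowStacking_of_eqOn (s := fun n => s (n + m)) (s' := fun n => t (n + u)) hh hu hn h1
    obtain ⟨k, i, j, hk⟩ := h2
    refine ⟨z₀ + barlowPos a₀ h₀ (fun n => t (n + u)) k i j, ?_, ?_⟩
    · rw [mem_barlowStacking_iff_sub_mem_shift (m := u) (i₀ := 0) (j₀ := 0), add_sub_cancel_left]
      exact barlowPos_mem _ _ _
    · have hyz : dist y (x - z₀ + (z₀ + barlowPos a₀ h₀ (fun n => t (n + u)) k i j)) =
          dist (y - x) (barlowPos a₀ h₀ (fun n => t (n + u)) k i j) := by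
        simp only [dist_eq_norm]
        congr 1
        abel
      rw [hg, hyz, hk]
      calc dist (barlowPos a h (fun n => t (n + u)) k i j)
            (barlowPos a₀ h₀ (fun n => t (n + u)) k i j)
          ≤ (|a - a₀| / |a| + |h - h₀| / |h|) * ‖barlowPos a h (fun n => t (n + u)) k i j‖ :=
            dist_barlowPos_le_of_haggLabel_eq ha hh rfl i j
        _ ≤ (δ / (a₀ / 2) + δ / (h₀ / 2)) * R := by
            refine mul_le_mul hμ1 ?_ (norm_nonneg _) hμ0
            rw [← hk, ← dist_eq_norm, dist_comm]
            exact hxy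
        _ ≤ ε := hμR
  · -- clause 2: the image of an hcp point near `x` is near a point of the stacking
    intro z hz hxz
    have h1 : z - z₀ ∈ barlowStacking a₀ h₀ (fun n => t (n + u)) :=
      (mem_barlowStacking_iff_sub_mem_shift (m := u) (i₀ := 0) (j₀ := 0) z).1 hz
    obtain ⟨k, i, j, hk⟩ := h1
    have hgz : (AffineIsometryEquiv.constVAdd ℝ (EuclideanSpace ℝ (Fin 3)) (x - z₀)) z =
        x + (z - z₀) := by
      rw [hg]
      abel
    rw [hgz] at hxz ⊢
    rw [dist_self_add_right] at hxz
    have hd : dist (z - z₀) (barlowPos a h (fun n => t (n + u)) k i j) ≤ ε := by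
      rw [hk]
      calc dist (barlowPos a₀ h₀ (fun n => t (n + u)) k i j)
            (barlowPos a h (fun n => t (n + u)) k i j)
          ≤ (|a₀ - a| / |a₀| + |h₀ - h| / |h₀|) *
              ‖barlowPos a₀ h₀ (fun n => t (n + u)) k i j‖ :=
            dist_barlowPos_le_of_haggLabel_eq ha₀.ne' hh₀.ne' rfl i j
        _ ≤ (δ / (a₀ / 2) + δ / (h₀ / 2)) * R := by
            refine mul_le_mul hμ2 ?_ (norm_nonneg _) hμ0
            rw [← hk]
            exact hxz
        _ ≤ ε := hμR
    have hvn : ‖barlowPos a h (fun n => t (n + u)) k i j‖ ≤ K * |h| := by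
      have h1 := norm_le_norm_add_norm_sub (z - z₀) (barlowPos a h (fun n => t (n + u)) k i j)
      have h2 : ‖z - z₀ - barlowPos a h (fun n => t (n + u)) k i j‖ ≤ ε := by
        rw [← dist_eq_norm]
        exact hd
      linarith
    have hv2 : barlowPos a h (fun n => t (n + u)) k i j ∈ barlowStacking a h (fun n => s (n + m)) :=
      mem_barlowStacking_of_eqOn (s := fun n => t (n + u)) (s' := fun n => s (n + m)) hh
        (fun n h1 h2 => (hu n h1 h2).symm) hvn (barlowPos_mem _ _ _)
    refine ⟨x + barlowPos a h (fun n => t (n + u)) k i j, ?_, ?_⟩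
    · rw [mem_barlowStacking_iff_sub_mem_shift (m := m) (i₀ := 0) (j₀ := 0), add_sub_cancel_left]
      exact hv2
    · rw [dist_add_left, dist_comm]
      exact hd

/-- **No bad bond near `m` ⇒ matched** (the matched case of the stub): under the scale hypotheses
of `matched_of_eqOn`, a Hägg word `s` with no bad bond `s (k + 1) = s k`, `|k - m| ≤ K`, has the
`R`-window of `barlowPos a h s m 0 0` two-way `ε`-matched with a rigid image of
`barlowStacking a₀ h₀ alternatingHagg`. [folklore] -/
theorem matched_of_noBadBond {a₀ h₀ R ε δ : ℝ} {K : ℕ} (ha₀ : 0 < a₀) (hh₀ : 0 < h₀) (hε : 0 ≤ ε)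
    (hδa : δ ≤ a₀ / 2) (hδh : δ ≤ h₀ / 2) (hδε : δ * (2 * R * (1 / a₀ + 1 / h₀)) ≤ ε)
    (hK : R + ε ≤ K * (h₀ / 2)) {a h : ℝ} (ha : a ≠ 0) (hh : h ≠ 0)
    (haδ : |a - a₀| ≤ δ) (hhδ : |h - h₀| ≤ δ) {s : ℤ → ℤ} (hs : IsHaggSeq s) {m : ℤ}
    (hgood : ∀ k : ℤ, |k - m| ≤ K → s (k + 1) ≠ s k) :
    ∃ g : EuclideanSpace ℝ (Fin 3) ≃ᵃⁱ[ℝ] EuclideanSpace ℝ (Fin 3),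
      (∀ y ∈ barlowStacking a h s, dist (barlowPos a h s m 0 0) y ≤ R →
        ∃ z ∈ barlowStacking a₀ h₀ alternatingHagg, dist y (g z) ≤ ε) ∧
      (∀ z ∈ barlowStacking a₀ h₀ alternatingHagg, dist (barlowPos a h s m 0 0) (g z) ≤ R →
        ∃ y ∈ barlowStacking a h s, dist y (g z) ≤ ε) := by
  obtain ⟨u, hu⟩ := exists_eqOn_alternating hs hgood
  exact matched_of_eqOn ha₀ hh₀ hε hδa hδh hδε hK ha hh haδ hhδ hu

/-! ### §3 Counting: unmatched motif indices are covered by `b_p` sets of size `≤ 2K + 1` -/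

/-- **Reducing a nearby bad bond modulo the period.**  If `s` is `p`-periodic, `n < p` and there
is a bad bond `k ∈ ℤ` (`s (k + 1) = s k`) with `|k - n| ≤ K`, then `n` lies in the image of
`[-K, K]` under `d ↦ (r + d) mod p` for the bad residue `r = k mod p ∈ [0, p)`. [folklore] -/
theorem mem_cover_of_badBond {s : ℤ → ℤ} {p : ℕ} (hp : p ≠ 0) (hs : ∀ i : ℤ, s (i + p) = s i)
    {K n : ℕ} (hn : n < p) {k : ℤ} (hk : |k - n| ≤ K) (hbad : s (k + 1) = s k) :
    n ∈ ((Finset.range p).filter (fun m : ℕ => s ((m : ℤ) + 1) = s m)).biUnion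
      (fun r : ℕ => (Finset.Icc (-(K : ℤ)) K).image
        (fun d : ℤ => (((r : ℤ) + d) % (p : ℤ)).toNat)) := by
  have hp0 : (0 : ℤ) < p := by exact_mod_cast Nat.pos_of_ne_zero hp
  have hq : k % (p : ℤ) = k - p * (k / p) := Int.emod_def k p
  have hper : ∀ x t : ℤ, s (x - t * p) = s x := fun x t =>
    (show Function.Periodic s (p : ℤ) from hs).sub_int_mul_eq t
  have h0 : 0 ≤ k % (p : ℤ) := Int.emod_nonneg _ hp0.ne'
  have h1 : k % (p : ℤ) < p := Int.emod_lt_of_pos _ hp0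
  rw [Finset.mem_biUnion]
  refine ⟨(k % (p : ℤ)).toNat, ?_, ?_⟩
  · rw [Finset.mem_filter, Finset.mem_range]
    refine ⟨by omega, ?_⟩
    rw [Int.toNat_of_nonneg h0, hq, show k - p * (k / p) + 1 = (k + 1) - (k / p) * p by ring,
      show k - p * (k / p) = k - (k / p) * p by ring, hper, hper, hbad]
  · rw [Finset.mem_image]
    refine ⟨n - k, ?_, ?_⟩
    · rw [abs_le] at hk
      rw [Finset.mem_Icc]
      omega
    · rw [Int.toNat_of_nonneg h0, hq, show k - p * (k / p) + ((n : ℤ) - k) = n + p * (-(k / p)) by ring,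
        Int.add_mul_emod_self_left, Int.emod_eq_of_lt (by omega) (by omega), Int.toNat_natCast]

/-- The cover has at most `(2K + 1) · #B` elements. [folklore] -/
theorem card_cover_le (B : Finset ℕ) (K p : ℕ) :
    (B.biUnion (fun r : ℕ => (Finset.Icc (-(K : ℤ)) K).image
      (fun d : ℤ => (((r : ℤ) + d) % (p : ℤ)).toNat))).card ≤ (2 * K + 1) * B.card := by
  refine Finset.card_biUnion_le.trans ?_
  refine (Finset.sum_le_sum fun r _ => Finset.card_image_le).trans ?_
  have htoNat : ((K : ℤ) + 1 - -(K : ℤ)).toNat = 2 * K + 1 := by omega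
  rw [Finset.sum_const, smul_eq_mul, Int.card_Icc, htoNat]
  exact (mul_comm _ _).le

/-- **Counting motif points through their indices.**  For the periodic configuration of a
`p`-periodic word, the motif points `x` failing a property `P` are at most as many as any finset
`F ⊆ ℕ` containing every index `n < p` with `¬ P (barlowPos a h s n 0 0)` (the motif is the image
of `range p` under `n ↦ barlowPos a h s n 0 0`). [folklore] -/
theorem natCard_motif_le_of_cover {a h : ℝ} (ha : a ≠ 0) (hh : h ≠ 0) {p : ℕ} (hp : p ≠ 0)
    {s : ℤ → ℤ} (hs : ∀ i : ℤ, s (i + p) = s i)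
    (P : EuclideanSpace ℝ (Fin 3) → Prop) (F : Finset ℕ)
    (hcover : ∀ n : ℕ, n < p → ¬ P (barlowPos a h s n 0 0) → n ∈ F) :
    Nat.card {x : (barlowPeriodicConfiguration s ha hh hp hs).motif // ¬ P x.1} ≤ F.card := by
  have key : ∀ x : {x : (barlowPeriodicConfiguration s ha hh hp hs).motif // ¬ P x.1},
      ∃ n ∈ F, barlowPos a h s n 0 0 = x.1.1 := by
    rintro ⟨⟨y, hy⟩, hU⟩
    have hy' : y ∈ (Finset.range p).image (fun m : ℕ => barlowPos a h s m 0 0) := hy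
    obtain ⟨n, hn, rfl⟩ := Finset.mem_image.1 hy'
    exact ⟨n, hcover n (Finset.mem_range.1 hn) hU, rfl⟩
  choose f hfF hfx using key
  have hinj : Function.Injective (fun x => (⟨f x, hfF x⟩ : F)) := by
    intro x x' hxx'
    have h' : f x = f x' := congrArg Subtype.val hxx'
    apply Subtype.ext
    apply Subtype.ext
    rw [← hfx x, ← hfx x', h']
  simpa only [Nat.card_eq_finsetCard] using Nat.card_le_card_of_injective _ hinj

/-- **The count, per configuration.**  Under the scale hypotheses of `matched_of_eqOn`, for a
`p`-periodic Hägg word `s` the motif points of `barlowPeriodicConfiguration s ha hh hp hs` whose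
`R`-window (read in its point set) is not two-way `ε`-matched with a rigid image of
`barlowStacking a₀ h₀ alternatingHagg` number at most `(2K + 1) · #{m < p : s (m+1) = s m}`.
[folklore] -/
theorem natCard_unmatched_le {a₀ h₀ R ε δ : ℝ} {K : ℕ} (ha₀ : 0 < a₀) (hh₀ : 0 < h₀) (hε : 0 ≤ ε)
    (hδa : δ ≤ a₀ / 2) (hδh : δ ≤ h₀ / 2) (hδε : δ * (2 * R * (1 / a₀ + 1 / h₀)) ≤ ε)
    (hK : R + ε ≤ K * (h₀ / 2)) {a h : ℝ} (ha : a ≠ 0) (hh : h ≠ 0)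
    (haδ : |a - a₀| ≤ δ) (hhδ : |h - h₀| ≤ δ) {p : ℕ} (hp : p ≠ 0) {s : ℤ → ℤ}
    (hs : ∀ i : ℤ, s (i + p) = s i) (hS : IsHaggSeq s) :
    (Nat.card {x : (barlowPeriodicConfiguration s ha hh hp hs).motif //
        ¬ ∃ g : EuclideanSpace ℝ (Fin 3) ≃ᵃⁱ[ℝ] EuclideanSpace ℝ (Fin 3),
          (∀ j : (barlowPeriodicConfiguration s ha hh hp hs).points, dist x.1 j.1 ≤ R →
            ∃ z ∈ barlowStacking a₀ h₀ alternatingHagg, dist j.1 (g z) ≤ ε) ∧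
          (∀ z ∈ barlowStacking a₀ h₀ alternatingHagg, dist x.1 (g z) ≤ R →
            ∃ j : (barlowPeriodicConfiguration s ha hh hp hs).points, dist j.1 (g z) ≤ ε)} : ℝ) ≤
      (2 * (K : ℝ) + 1) *
        (((Finset.range p).filter (fun m : ℕ => s ((m : ℤ) + 1) = s m)).card : ℝ) := by
  have hpts : (barlowPeriodicConfiguration s ha hh hp hs).points = barlowStacking a h s :=
    barlowPeriodicConfiguration_points s ha hh hp hs
  have hcover : ∀ n : ℕ, n < p →
      (¬ ∃ g : EuclideanSpace ℝ (Fin 3) ≃ᵃⁱ[ℝ] EuclideanSpace ℝ (Fin 3),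
          (∀ j : (barlowPeriodicConfiguration s ha hh hp hs).points,
            dist (barlowPos a h s n 0 0) j.1 ≤ R →
              ∃ z ∈ barlowStacking a₀ h₀ alternatingHagg, dist j.1 (g z) ≤ ε) ∧
          (∀ z ∈ barlowStacking a₀ h₀ alternatingHagg, dist (barlowPos a h s n 0 0) (g z) ≤ R →
            ∃ j : (barlowPeriodicConfiguration s ha hh hp hs).points, dist j.1 (g z) ≤ ε)) →
      n ∈ ((Finset.range p).filter (fun m : ℕ => s ((m : ℤ) + 1) = s m)).biUnion
        (fun r : ℕ => (Finset.Icc (-(K : ℤ)) K).image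
          (fun d : ℤ => (((r : ℤ) + d) % (p : ℤ)).toNat)) := by
    intro n hn hU
    by_contra hnF
    apply hU
    obtain ⟨g, h1, h2⟩ := matched_of_noBadBond ha₀ hh₀ hε hδa hδh hδε hK ha hh haδ hhδ hS
      (m := (n : ℤ)) (fun k hk hbad => hnF (mem_cover_of_badBond hp hs hn hk hbad))
    refine ⟨g, fun j hj => h1 j.1 (hpts ▸ j.2) hj, fun z hz hzR => ?_⟩
    obtain ⟨y, hy, hd⟩ := h2 z hz hzR
    exact ⟨⟨y, hpts ▸ hy⟩, hd⟩
  have h1 := natCard_motif_le_of_cover ha hh hp hs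
    (fun y => ∃ g : EuclideanSpace ℝ (Fin 3) ≃ᵃⁱ[ℝ] EuclideanSpace ℝ (Fin 3),
      (∀ j : (barlowPeriodicConfiguration s ha hh hp hs).points, dist y j.1 ≤ R →
        ∃ z ∈ barlowStacking a₀ h₀ alternatingHagg, dist j.1 (g z) ≤ ε) ∧
      (∀ z ∈ barlowStacking a₀ h₀ alternatingHagg, dist y (g z) ≤ R →
        ∃ j : (barlowPeriodicConfiguration s ha hh hp hs).points, dist j.1 (g z) ≤ ε)) _ hcover
  have h2 := card_cover_le ((Finset.range p).filter (fun m : ℕ => s ((m : ℤ) + 1) = s m)) K p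
  exact_mod_cast h1.trans h2

/-- **stub_unmatchedNearBadBond** (GEOMETRY OF IDEAL STACKINGS).  Fix `a₀, h₀ > 0` and a window
`(R, ε)`.  There are `δ > 0` and `K : ℕ` such that for every scale `(a, h)` with `|a − a₀| ≤ δ`,
`|h − h₀| ≤ δ`, every `p`-periodic Hägg word `s` and `Q = barlowPeriodicConfiguration s ha hh hp hs`:
the motif points whose `R`-window in `Q.points` is NOT two-way `ε`-matched with a rigid image of
`barlowStacking a₀ h₀ alternatingHagg` number at most `(2K+1)·b_p`, `b_p = #{m < p : s (m+1) = s m}`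
(`δ = min (min (a₀/2) (h₀/2)) (ε/(2R(1/a₀ + 1/h₀) + 1))`, `K = ⌈2(R + ε)/h₀⌉₊`;
`natCard_unmatched_le`). [folklore] -/
theorem stub_unmatchedNearBadBond : ∀ (a₀ h₀ : ℝ), 0 < a₀ → 0 < h₀ → ∀ R ε : ℝ, 0 < R → 0 < ε → ∃ δ : ℝ, 0 < δ ∧ ∃ K : ℕ, ∀ (a h : ℝ) (ha : a ≠ 0) (hh : h ≠ 0), |a - a₀| ≤ δ → |h - h₀| ≤ δ → ∀ (p : ℕ) (hp : p ≠ 0) (s : ℤ → ℤ) (hs : ∀ i : ℤ, s (i + p) = s i), Literature.MathematicalPhysics.StatisticalMechanics.IsHaggSeq s → (Nat.card {x : (Literature.MathematicalPhysics.StatisticalMechanics.barlowPeriodicConfiguration s ha hh hp hs).motif // ¬ ∃ g : EuclideanSpace ℝ (Fin 3) ≃ᵃⁱ[ℝ] EuclideanSpace ℝ (Fin 3), (∀ j : (Literature.MathematicalPhysics.StatisticalMechanics.barlowPeriodicConfiguration s ha hh hp hs).points, dist ((Subtype.val : (Literature.MathematicalPhysics.StatisticalMechanics.barlowPeriodicConfiguration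 s ha hh hp hs).points → EuclideanSpace ℝ (Fin 3)) ⟨x.1, (Literature.MathematicalPhysics.StatisticalMechanics.barlowPeriodicConfiguration s ha hh hp hs).mem_points_of_mem_motif x.2⟩) ((Subtype.val : (Literature.MathematicalPhysics.StatisticalMechanics.barlowPeriodicConfiguration s ha hh hp hs).points → EuclideanSpace ℝ (Fin 3)) j) ≤ R → ∃ z ∈ Literature.MathematicalPhysics.StatisticalMechanics.barlowStacking a₀ h₀ Literature.MathematicalPhysics.StatisticalMechanics.alternatingHagg, dist ((Subtype.val : (Literature.MathematicalPhysics.StatisticalMechanics.barlowPeriodicConfiguration s ha hh hp hs).points → EuclideanSpace ℝ (Fin 3)) j) (g z) ≤ ε) ∧ (∀ z ∈ Literature.MathematicalPhysics.StatisticalMechanics.barlowStacking a₀ h₀ Literature.MathematicalPhysics.StatisticalMechanics.alternatingHagg, dist ((Subtype.val : (Literature.MathematicalPhysics.StatisticalMechanics.barlowPeriodicConfiguration s ha hh hp hs).points → EuclideanSpace ℝ (Fin 3)) ⟨x.1, (Literature.MathematicalPhysics.StatisticalMechanics.barlowPeriodicConfiguration s ha hh hp hs).mem_points_of_mem_motif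 x.2⟩) (g z) ≤ R → ∃ j : (Literature.MathematicalPhysics.StatisticalMechanics.barlowPeriodicConfiguration s ha hh hp hs).points, dist ((Subtype.val : (Literature.MathematicalPhysics.StatisticalMechanics.barlowPeriodicConfiguration s ha hh hp hs).points → EuclideanSpace ℝ (Fin 3)) j) (g z) ≤ ε)} : ℝ) ≤ (2 * (K : ℝ) + 1) * (((Finset.range p).filter (fun m : ℕ => s ((m : ℤ) + 1) = s m)).card : ℝ) := by
  intro a₀ h₀ ha₀ hh₀ R ε hR hε
  have hM : 0 ≤ 2 * R * (1 / a₀ + 1 / h₀) := by positivity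
  refine ⟨min (min (a₀ / 2) (h₀ / 2)) (ε / (2 * R * (1 / a₀ + 1 / h₀) + 1)), by positivity,
    ⌈2 * (R + ε) / h₀⌉₊, ?_⟩
  intro a h ha hh haδ hhδ p hp s hs hS
  refine natCard_unmatched_le ha₀ hh₀ hε.le ((min_le_left _ _).trans (min_le_left _ _))
    ((min_le_left _ _).trans (min_le_right _ _)) ?_ ?_ ha hh haδ hhδ hp hs hS
  · calc min (min (a₀ / 2) (h₀ / 2)) (ε / (2 * R * (1 / a₀ + 1 / h₀) + 1)) *
          (2 * R * (1 / a₀ + 1 / h₀))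
        ≤ ε / (2 * R * (1 / a₀ + 1 / h₀) + 1) * (2 * R * (1 / a₀ + 1 / h₀)) :=
          mul_le_mul_of_nonneg_right (min_le_right _ _) hM
      _ ≤ ε := by
          rw [div_mul_eq_mul_div, div_le_iff₀ (by positivity)]
          nlinarith
  · have h1 := Nat.le_ceil (2 * (R + ε) / h₀)
    calc R + ε = 2 * (R + ε) / h₀ * (h₀ / 2) := by
          field_simp
      _ ≤ _ := mul_le_mul_of_nonneg_right h1 (by positivity)

end Summit.AtomisticToContinuum.Crystallization.Theorems.PricedHcpWindowsIdealGeometry
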